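import Summits.QuantumFields.YangMills.Theorems.IR.EsPolymerESRung
import Summits.QuantumFields.YangMills.Theorems.IR.EsPolymerDefsK

/-!
# Crux `IR` (item stmt-QuantumFields-19354) — line «es-polymer-decoupling», reshaped: THE RUNG AT EVERY BLOCK RADIUS
`stub_esRungK : ESRungK`, proved

Helper module for item `stmt-QuantumFields-19354` (`--supports … --as helper`; lead prover ym-ir-line-mxc-p1 g2).  It proves
`ESRungK` of `Theorems/IR/EsPolymerDefsK.lean` (the lead's reshape of the es-polymer format after the engine stub was found
misstated): for every compact `G`, continuous `ρ`, `p > 0` there is `β₀ > 0` with `DPRk ρ β S 1 p` for `|β| ≤ β₀` and all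
`S` — the Edwards–Sokal sub-measures `esSub` of `Theorems/IR/EsPolymerESMeasures.lean` satisfy clauses (I)_k (D)_k at EVERY
block radius `k` (`esSub_indepK`, `esSub_nearFamily`): the three-block factorisation of `Theorems/IR/EsPolymerESRung.lean`
with the cell sets `ball(c_A,k) ∪ ⋃ nearFamily`, `ball(c_B,k) ∪ ⋃(near B, not near A)`, rest — pairwise at cell
distance `≥ 2` because blocks are `≥ 2k+2` apart, a polymer outside the near family of `c` is `≥ k+2` from `c`
(`le_cellDist_of_not_mem_nearFamily`), and distinct polymers are `≥ 7` apart.  `dpr_of_dprk`: the reshape refines `DPR`.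

HONEST FRAMING: the strong-coupling (small `|β|`) rung of a CONDITIONAL rung line; the line's load `IRPolymerCertK` and
the Yang–Mills mass gap are NOT proved here. -/

set_option autoImplicit false

noncomputable section

open MeasureTheory ProbabilityTheory Finset Function
open scoped NNReal ENNReal
open Literature.MathematicalPhysics.QuantumFieldTheory

namespace Summit.QuantumFields.YangMills.Cruxes.IR.EsPolymer

/-! ## §1 Near families and blocks: the cell-distance bookkeeping at radius `k` -/

/-- A sub-family of a compatible family is compatible. -/
theorem compatible_of_subset {q : ℕ} {Γ Γ' : Finset (Finset (Cell q))} (hΓ : Compatible Γ) (h : Γ' ⊆ Γ) :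
    Compatible Γ' :=
  ⟨fun γ hγ => hΓ.1 γ (h hγ), fun γ hγ γ' hγ' => hΓ.2 γ (h hγ) γ' (h hγ')⟩

/-- A cell within `k` of `c`, or in a polymer of the near family of `c`, is at cell distance `≥ 2` from every cell of
every polymer of `Γ` OUTSIDE the near family of `c`. -/
theorem two_le_cellDist_of_not_mem_nearFamily {q : ℕ} {Γ : Finset (Finset (Cell q))} (hΓ : Compatible Γ)
    {c x y : Cell q} {k : ℕ} {γ : Finset (Cell q)} (hx : cellDist c x ≤ k ∨ ∃ γ' ∈ nearFamily Γ c k, x ∈ γ')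
    (hγ : γ ∈ Γ) (hn : γ ∉ nearFamily Γ c k) (hy : y ∈ γ) : 2 ≤ cellDist x y := by
  rcases hx with hx | ⟨γ', hγ', hx⟩
  · have h1 := le_cellDist_of_not_mem_nearFamily hγ hn hy
    have h2 := cellDist_triangle c x y
    omega
  · have hne : γ' ≠ γ := fun h => hn (h ▸ hγ')
    have h7 := hΓ.2 γ' (nearFamily_subset Γ c k hγ') γ hγ hne x hx y hy
    omega

/-- The two block-plus-near-family cell sets of clause (I)_k are at cell distance `≥ 2`. -/
theorem two_le_cellDist_blocksK {q : ℕ} {Γ : Finset (Finset (Cell q))} (hΓ : Compatible Γ) {cA cB x y : Cell q}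
    {k : ℕ} (hd : 2 * k + 2 ≤ cellDist cA cB) (hdisj : Disjoint (nearFamily Γ cA k) (nearFamily Γ cB k))
    (hx : cellDist cA x ≤ k ∨ ∃ γ ∈ nearFamily Γ cA k, x ∈ γ)
    (hy : cellDist cB y ≤ k ∨ ∃ γ ∈ nearFamily Γ cB k, y ∈ γ) : 2 ≤ cellDist x y := by
  rcases hy with hy | ⟨γ, hγ, hyγ⟩
  · rcases hx with hx | ⟨γ', hγ', hxγ'⟩
    · have h1 := cellDist_triangle cA x cB
      have h2 := cellDist_triangle x y cB
      rw [cellDist_comm cB y] at hy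
      omega
    · have hn : γ' ∉ nearFamily Γ cB k := Finset.disjoint_left.1 hdisj hγ'
      have := two_le_cellDist_of_not_mem_nearFamily hΓ (Or.inl hy) (nearFamily_subset _ _ _ hγ') hn hxγ'
      rwa [cellDist_comm] at this
  · have hn : γ ∉ nearFamily Γ cA k := Finset.disjoint_right.1 hdisj hγ
    exact two_le_cellDist_of_not_mem_nearFamily hΓ hx (nearFamily_subset _ _ _ hγ) hn hyγ

variable {N : ℕ} [NeZero N] {G : Type}

/-- An observable of the radius-`k` block about `c` (mesh `1`) reads only the links of the cells within `k` of `c`. -/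
theorem dependsOn_blockK_of_blockEdges {A : GaugeConfig 4 N G → ℝ} {c : Cell N} {k : ℕ}
    (hA : DependsOn A (blockEdges N N (fun _ j => j) c k)) :
    DependsOn A (↑((Finset.univ.filter fun c' : Cell N => cellDist c c' ≤ k).biUnion cellLinks) : Set (Edge 4 N)) := by
  refine DependsOn.mono (fun e he => ?_) hA
  obtain ⟨c', hc', he⟩ := he
  rw [torusCellEdges_unit, Finset.mem_image] at he
  obtain ⟨i, -, rfl⟩ := he
  exact Finset.mem_coe.2 (Finset.mem_biUnion.2 ⟨c', Finset.mem_filter.2 ⟨Finset.mem_univ _, hc'⟩, base_mem_cellLinks c' i⟩)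

variable [Group G] [TopologicalSpace G] [IsTopologicalGroup G] [CompactSpace G] [MeasurableSpace G] [BorelSpace G]
  {n : ℕ} {ρ : G →* Matrix (Fin n) (Fin n) ℂ} {β m : ℝ}

omit [TopologicalSpace G] [IsTopologicalGroup G] [CompactSpace G] [MeasurableSpace G] [BorelSpace G] in
/-- Splitting the density of a compatible family along a predicate: each part contributes the polymer factor of its
union. -/
theorem prod_polyFactor_filter_split {Γ : Finset (Finset (Cell N))} (hΓ : Compatible Γ) (P : Finset (Cell N) → Prop)
    [DecidablePred P] (U : GaugeConfig 4 N G) :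
    ∏ γ ∈ Γ, polyFactor ρ β m γ U =
      polyFactor ρ β m ((Γ.filter P).biUnion id) U *
        polyFactor ρ β m ((Γ.filter fun γ => ¬ P γ).biUnion id) U := by
  rw [← prod_filter_mul_prod_filter_not Γ P, polyFactor_biUnion (compatible_of_subset hΓ (filter_subset _ _)),
    polyFactor_biUnion (compatible_of_subset hΓ (filter_subset _ _))]

omit [TopologicalSpace G] [IsTopologicalGroup G] [CompactSpace G] [MeasurableSpace G] [BorelSpace G] in
/-- The same split for the polymer factor of the union of a compatible family. -/
theorem polyFactor_biUnion_filter_split {Γ : Finset (Finset (Cell N))} (hΓ : Compatible Γ)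
    (P : Finset (Cell N) → Prop) [DecidablePred P] (U : GaugeConfig 4 N G) :
    polyFactor ρ β m (Γ.biUnion id) U =
      polyFactor ρ β m ((Γ.filter P).biUnion id) U *
        polyFactor ρ β m ((Γ.filter fun γ => ¬ P γ).biUnion id) U := by
  rw [polyFactor_biUnion hΓ, prod_polyFactor_filter_split hΓ P U]

/-! ## §2 Clauses (I)_k and (D)_k for the Edwards–Sokal sub-measures -/

/-- **Clause (I)_k**: conditionally on a compatible family, radius-`k` block observables at cell distance `≥ 2k+2` with
disjoint near families are uncorrelated. -/
theorem esSub_indepK (hρ : Continuous ρ) (hm : 0 < m) {M : ℝ}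
    (hW : ∀ (c : Cell N) (U : GaugeConfig 4 N G), m ≤ cellWeight ρ β c U ∧ cellWeight ρ β c U ≤ M)
    {Γ : Finset (Finset (Cell N))} (hΓ : Compatible Γ) (k : ℕ) (cA cB : Cell N) (A B : GaugeConfig 4 N G → ℝ)
    (hAm : Measurable A) (hBm : Measurable B) (hA : DependsOn A (blockEdges N N (fun _ j => j) cA k))
    (hB : DependsOn B (blockEdges N N (fun _ j => j) cB k)) (hd : 2 * k + 2 ≤ cellDist cA cB)
    (hdisj : Disjoint (nearFamily Γ cA k) (nearFamily Γ cB k)) :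
    (esSub ρ β m Γ Set.univ).toReal * ∫ U, A U * B U ∂(esSub ρ β m Γ) =
      (∫ U, A U ∂(esSub ρ β m Γ)) * ∫ U, B U ∂(esSub ρ β m Γ) := by
  classical
  -- the three sub-families: near `A`; near `B` but not near `A`; the rest
  set Γ₁ : Finset (Finset (Cell N)) := Γ.filter fun γ => ¬ ∃ c' ∈ γ, cellDist cA c' ≤ k + 1 with hΓ₁
  set ΓB : Finset (Finset (Cell N)) := Γ₁.filter fun γ => ∃ c' ∈ γ, cellDist cB c' ≤ k + 1 with hΓB
  set ΓR : Finset (Finset (Cell N)) := Γ₁.filter fun γ => ¬ ∃ c' ∈ γ, cellDist cB c' ≤ k + 1 with hΓR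
  have hΓ₁c : Compatible Γ₁ := compatible_of_subset hΓ (filter_subset _ _)
  have memΓ₁ : ∀ γ ∈ Γ₁, γ ∈ Γ ∧ γ ∉ nearFamily Γ cA k := fun γ hγ => by
    obtain ⟨hγΓ, hnA⟩ := mem_filter.1 hγ
    exact ⟨hγΓ, fun h => hnA (mem_nearFamily.1 h).2⟩
  have memΓB : ∀ γ ∈ ΓB, γ ∈ Γ ∧ γ ∉ nearFamily Γ cA k ∧ γ ∈ nearFamily Γ cB k := fun γ hγ => by
    obtain ⟨hγ₁, hPB⟩ := mem_filter.1 hγ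
    exact ⟨(memΓ₁ γ hγ₁).1, (memΓ₁ γ hγ₁).2, mem_nearFamily.2 ⟨(memΓ₁ γ hγ₁).1, hPB⟩⟩
  have memΓR : ∀ γ ∈ ΓR, γ ∈ Γ ∧ γ ∉ nearFamily Γ cA k ∧ γ ∉ nearFamily Γ cB k := fun γ hγ => by
    obtain ⟨hγ₁, hnB⟩ := mem_filter.1 hγ
    exact ⟨(memΓ₁ γ hγ₁).1, (memΓ₁ γ hγ₁).2, fun h => hnB (mem_nearFamily.1 h).2⟩
  have hD : ∀ U : GaugeConfig 4 N G, ∏ γ ∈ Γ, polyFactor ρ β m γ U =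
      polyFactor ρ β m ((nearFamily Γ cA k).biUnion id) U * polyFactor ρ β m (ΓB.biUnion id) U *
        polyFactor ρ β m (ΓR.biUnion id) U := fun U => by
    have h1 : ∏ γ ∈ Γ, polyFactor ρ β m γ U =
        polyFactor ρ β m ((nearFamily Γ cA k).biUnion id) U * polyFactor ρ β m (Γ₁.biUnion id) U :=
      prod_polyFactor_filter_split hΓ (fun γ => ∃ c' ∈ γ, cellDist cA c' ≤ k + 1) U
    have h2 : polyFactor ρ β m (Γ₁.biUnion id) U =
        polyFactor ρ β m (ΓB.biUnion id) U * polyFactor ρ β m (ΓR.biUnion id) U :=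
      polyFactor_biUnion_filter_split hΓ₁c (fun γ => ∃ c' ∈ γ, cellDist cB c' ≤ k + 1) U
    rw [h1, h2, mul_assoc]
  -- the three cell sets and their separation
  set KA : Finset (Cell N) :=
    (Finset.univ.filter fun c' : Cell N => cellDist cA c' ≤ k) ∪ (nearFamily Γ cA k).biUnion id with hKA
  set KB : Finset (Cell N) := (Finset.univ.filter fun c' : Cell N => cellDist cB c' ≤ k) ∪ ΓB.biUnion id with hKB
  have memKA : ∀ x ∈ KA, cellDist cA x ≤ k ∨ ∃ γ ∈ nearFamily Γ cA k, x ∈ γ := fun x hx => by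
    rcases mem_union.1 hx with h | h
    · exact Or.inl (mem_filter.1 h).2
    · obtain ⟨γ, hγ, hxγ⟩ := mem_biUnion.1 h
      exact Or.inr ⟨γ, hγ, hxγ⟩
  have memKB : ∀ y ∈ KB, cellDist cB y ≤ k ∨ ∃ γ ∈ nearFamily Γ cB k, y ∈ γ := fun y hy => by
    rcases mem_union.1 hy with h | h
    · exact Or.inl (mem_filter.1 h).2
    · obtain ⟨γ, hγ, hyγ⟩ := mem_biUnion.1 h
      exact Or.inr ⟨γ, (memΓB γ hγ).2.2, hyγ⟩
  have hAB : ∀ x ∈ KA, ∀ y ∈ KB, 2 ≤ cellDist x y := fun x hx y hy =>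
    two_le_cellDist_blocksK hΓ hd hdisj (memKA x hx) (memKB y hy)
  have hAR : ∀ x ∈ KA, ∀ y ∈ ΓR.biUnion id, 2 ≤ cellDist x y := fun x hx y hy => by
    obtain ⟨γ, hγ, hyγ⟩ := mem_biUnion.1 hy
    exact two_le_cellDist_of_not_mem_nearFamily hΓ (memKA x hx) (memΓR γ hγ).1 (memΓR γ hγ).2.1 hyγ
  have hBR : ∀ x ∈ KB, ∀ y ∈ ΓR.biUnion id, 2 ≤ cellDist x y := fun x hx y hy => by
    obtain ⟨γ, hγ, hyγ⟩ := mem_biUnion.1 hy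
    exact two_le_cellDist_of_not_mem_nearFamily hΓ (memKB x hx) (memΓR γ hγ).1 (memΓR γ hγ).2.2 hyγ
  -- what each factor reads
  have hFa : DependsOn (polyFactor (G := G) ρ β m ((nearFamily Γ cA k).biUnion id))
      (↑(KA.biUnion cellLinks) : Set (Edge 4 N)) :=
    (dependsOn_polyFactor _).mono (Finset.coe_subset.2 (biUnion_subset_biUnion_of_subset_left _ subset_union_right))
  have hFb : DependsOn (polyFactor (G := G) ρ β m (ΓB.biUnion id)) (↑(KB.biUnion cellLinks) : Set (Edge 4 N)) :=
    (dependsOn_polyFactor _).mono (Finset.coe_subset.2 (biUnion_subset_biUnion_of_subset_left _ subset_union_right))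
  have hAd : DependsOn A (↑(KA.biUnion cellLinks) : Set (Edge 4 N)) :=
    (dependsOn_blockK_of_blockEdges hA).mono
      (Finset.coe_subset.2 (biUnion_subset_biUnion_of_subset_left _ subset_union_left))
  have hBd : DependsOn B (↑(KB.biUnion cellLinks) : Set (Edge 4 N)) :=
    (dependsOn_blockK_of_blockEdges hB).mono
      (Finset.coe_subset.2 (biUnion_subset_biUnion_of_subset_left _ subset_union_left))
  have hAFa : DependsOn (fun U => A U * polyFactor ρ β m ((nearFamily Γ cA k).biUnion id) U)
      (↑(KA.biUnion cellLinks) : Set (Edge 4 N)) :=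
    (dependsOn_mul hAd hFa).mono (Set.union_subset subset_rfl subset_rfl)
  have hBFb : DependsOn (fun U => B U * polyFactor ρ β m (ΓB.biUnion id) U) (↑(KB.biUnion cellLinks) : Set (Edge 4 N)) :=
    (dependsOn_mul hBd hFb).mono (Set.union_subset subset_rfl subset_rfl)
  have hR : DependsOn (polyFactor (G := G) ρ β m (ΓR.biUnion id)) (↑((ΓR.biUnion id).biUnion cellLinks) : Set (Edge 4 N)) :=
    dependsOn_polyFactor _
  have hFam := measurable_polyFactor (N := N) (β := β) (m := m) hρ ((nearFamily Γ cA k).biUnion id)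
  have hFbm := measurable_polyFactor (N := N) (β := β) (m := m) hρ (ΓB.biUnion id)
  have hRm := measurable_polyFactor (N := N) (β := β) (m := m) hρ (ΓR.biUnion id)
  -- the four factorisations
  have I1 := integral_mul_mul_eq_of_dependsOn hAB hAR hBR hFa hFam hFb hFbm hR hRm
  have I2 := integral_mul_mul_eq_of_dependsOn hAB hAR hBR hAFa (hAm.mul hFam) hBFb (hBm.mul hFbm) hR hRm
  have I3 := integral_mul_mul_eq_of_dependsOn hAB hAR hBR hAFa (hAm.mul hFam) hFb hFbm hR hRm
  have I4 := integral_mul_mul_eq_of_dependsOn hAB hAR hBR hFa hFam hBFb (hBm.mul hFbm) hR hRm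
  rw [mass_esSub_eq_integral hρ hm hW hΓ, integral_esSub hρ hm hW hΓ, integral_esSub hρ hm hW hΓ,
    integral_esSub hρ hm hW hΓ]
  simp_rw [hD]
  have e2 : ∀ U : GaugeConfig 4 N G,
      polyFactor ρ β m ((nearFamily Γ cA k).biUnion id) U * polyFactor ρ β m (ΓB.biUnion id) U *
          polyFactor ρ β m (ΓR.biUnion id) U * (A U * B U) =
        A U * polyFactor ρ β m ((nearFamily Γ cA k).biUnion id) U * (B U * polyFactor ρ β m (ΓB.biUnion id) U) *
          polyFactor ρ β m (ΓR.biUnion id) U := fun U => by ring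
  have e3 : ∀ U : GaugeConfig 4 N G,
      polyFactor ρ β m ((nearFamily Γ cA k).biUnion id) U * polyFactor ρ β m (ΓB.biUnion id) U *
          polyFactor ρ β m (ΓR.biUnion id) U * A U =
        A U * polyFactor ρ β m ((nearFamily Γ cA k).biUnion id) U * polyFactor ρ β m (ΓB.biUnion id) U *
          polyFactor ρ β m (ΓR.biUnion id) U := fun U => by ring
  have e4 : ∀ U : GaugeConfig 4 N G,
      polyFactor ρ β m ((nearFamily Γ cA k).biUnion id) U * polyFactor ρ β m (ΓB.biUnion id) U *
          polyFactor ρ β m (ΓR.biUnion id) U * B U =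
        polyFactor ρ β m ((nearFamily Γ cA k).biUnion id) U * (B U * polyFactor ρ β m (ΓB.biUnion id) U) *
          polyFactor ρ β m (ΓR.biUnion id) U := fun U => by ring
  simp_rw [e2, e3, e4]
  rw [I1, I2, I3, I4]
  ring

/-- **Clause (D)_k**: conditionally on a compatible family, the mean of a radius-`k` block observable depends on the
family only through the near family of the block's centre. -/
theorem esSub_nearFamily (hρ : Continuous ρ) (hm : 0 < m) {M : ℝ}
    (hW : ∀ (c : Cell N) (U : GaugeConfig 4 N G), m ≤ cellWeight ρ β c U ∧ cellWeight ρ β c U ≤ M)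
    (k : ℕ) (cA : Cell N) (A : GaugeConfig 4 N G → ℝ) (hAm : Measurable A)
    (hA : DependsOn A (blockEdges N N (fun _ j => j) cA k)) :
    ∃ Φ : Finset (Finset (Cell N)) → ℝ, ∀ Γ : Finset (Finset (Cell N)), Compatible Γ →
      ∫ U, A U ∂(esSub ρ β m Γ) = (esSub ρ β m Γ Set.univ).toReal * Φ (nearFamily Γ cA k) := by
  classical
  refine ⟨fun F => (∫ U, A U * polyFactor ρ β m (F.biUnion id) U ∂(Measure.pi fun _ : Edge 4 N => haarProbability G)) /
    ∫ U, polyFactor ρ β m (F.biUnion id) U ∂(Measure.pi fun _ : Edge 4 N => haarProbability G), fun Γ hΓ => ?_⟩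
  set ΓR : Finset (Finset (Cell N)) := Γ.filter fun γ => ¬ ∃ c' ∈ γ, cellDist cA c' ≤ k + 1 with hΓR
  have memΓR : ∀ γ ∈ ΓR, γ ∈ Γ ∧ γ ∉ nearFamily Γ cA k := fun γ hγ => by
    obtain ⟨hγΓ, hnA⟩ := mem_filter.1 hγ
    exact ⟨hγΓ, fun h => hnA (mem_nearFamily.1 h).2⟩
  have hD : ∀ U : GaugeConfig 4 N G, ∏ γ ∈ Γ, polyFactor ρ β m γ U =
      polyFactor ρ β m ((nearFamily Γ cA k).biUnion id) U * polyFactor ρ β m (ΓR.biUnion id) U := fun U =>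
    prod_polyFactor_filter_split hΓ (fun γ => ∃ c' ∈ γ, cellDist cA c' ≤ k + 1) U
  set KA : Finset (Cell N) :=
    (Finset.univ.filter fun c' : Cell N => cellDist cA c' ≤ k) ∪ (nearFamily Γ cA k).biUnion id with hKA
  have memKA : ∀ x ∈ KA, cellDist cA x ≤ k ∨ ∃ γ ∈ nearFamily Γ cA k, x ∈ γ := fun x hx => by
    rcases mem_union.1 hx with h | h
    · exact Or.inl (mem_filter.1 h).2
    · obtain ⟨γ, hγ, hxγ⟩ := mem_biUnion.1 h
      exact Or.inr ⟨γ, hγ, hxγ⟩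
  have hAR : ∀ x ∈ KA, ∀ y ∈ ΓR.biUnion id, 2 ≤ cellDist x y := fun x hx y hy => by
    obtain ⟨γ, hγ, hyγ⟩ := mem_biUnion.1 hy
    exact two_le_cellDist_of_not_mem_nearFamily hΓ (memKA x hx) (memΓR γ hγ).1 (memΓR γ hγ).2 hyγ
  have hFa : DependsOn (polyFactor (G := G) ρ β m ((nearFamily Γ cA k).biUnion id))
      (↑(KA.biUnion cellLinks) : Set (Edge 4 N)) :=
    (dependsOn_polyFactor _).mono (Finset.coe_subset.2 (biUnion_subset_biUnion_of_subset_left _ subset_union_right))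
  have hAd : DependsOn A (↑(KA.biUnion cellLinks) : Set (Edge 4 N)) :=
    (dependsOn_blockK_of_blockEdges hA).mono
      (Finset.coe_subset.2 (biUnion_subset_biUnion_of_subset_left _ subset_union_left))
  have hAFa : DependsOn (fun U => A U * polyFactor ρ β m ((nearFamily Γ cA k).biUnion id) U)
      (↑(KA.biUnion cellLinks) : Set (Edge 4 N)) :=
    (dependsOn_mul hAd hFa).mono (Set.union_subset subset_rfl subset_rfl)
  have hR : DependsOn (polyFactor (G := G) ρ β m (ΓR.biUnion id)) (↑((ΓR.biUnion id).biUnion cellLinks) : Set (Edge 4 N)) :=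
    dependsOn_polyFactor _
  have hFam := measurable_polyFactor (N := N) (β := β) (m := m) hρ ((nearFamily Γ cA k).biUnion id)
  have hRm := measurable_polyFactor (N := N) (β := β) (m := m) hρ (ΓR.biUnion id)
  have I1 := integral_mul_eq_of_dependsOn hAR hFa hFam hR hRm
  have I2 := integral_mul_eq_of_dependsOn hAR hAFa (hAm.mul hFam) hR hRm
  rw [mass_esSub_eq_integral hρ hm hW hΓ, integral_esSub hρ hm hW hΓ]
  simp_rw [hD]
  have e : ∀ U : GaugeConfig 4 N G,
      polyFactor ρ β m ((nearFamily Γ cA k).biUnion id) U * polyFactor ρ β m (ΓR.biUnion id) U * A U =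
        A U * polyFactor ρ β m ((nearFamily Γ cA k).biUnion id) U * polyFactor ρ β m (ΓR.biUnion id) U :=
    fun U => by ring
  simp_rw [e]
  rw [I1, I2]
  by_cases h0 : ∫ U, polyFactor ρ β m ((nearFamily Γ cA k).biUnion id) U
      ∂(Measure.pi fun _ : Edge 4 N => haarProbability G) = 0
  · -- a vanishing activity kills the polymer factor almost everywhere
    have hint : Integrable (polyFactor ρ β m ((nearFamily Γ cA k).biUnion id))
        (Measure.pi fun _ : Edge 4 N => haarProbability G) :=
      Integrable.of_bound hFam.aestronglyMeasurable ((M / m - 1) ^ ((nearFamily Γ cA k).biUnion id).card)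
        (ae_of_all _ fun U => by
          rw [Real.norm_eq_abs, abs_of_nonneg (polyFactor_bounds hm hW _ U).1]
          exact (polyFactor_bounds hm hW _ U).2)
    have hae : polyFactor ρ β m ((nearFamily Γ cA k).biUnion id) =ᵐ[Measure.pi fun _ : Edge 4 N => haarProbability G] 0 :=
      (integral_eq_zero_iff_of_nonneg (fun U => (polyFactor_bounds hm hW _ U).1) hint).1 h0
    have hzero : ∫ U, A U * polyFactor ρ β m ((nearFamily Γ cA k).biUnion id) U
        ∂(Measure.pi fun _ : Edge 4 N => haarProbability G) = 0 :=
      integral_eq_zero_of_ae (hae.mono fun U hU => by simp [hU])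
    rw [hzero, h0]
    simp
  · field_simp

/-! ## §3 Assembly: `DPRk` at mesh `1` from a floor and a ceiling, and the rung -/

omit [NeZero N] in
/-- **`DPRk ρ β S 1 p` from `m ≤ W_c ≤ M` with `0 ≤ M/m − 1 ≤ p`.** -/
theorem dprk_one_of_bounds (S : ℕ) (hρ : Continuous ρ) {M p : ℝ} (hm : 0 < m)
    (hW : ∀ (c : Cell (2 * S + 1)) (U : GaugeConfig 4 (2 * S + 1) G), m ≤ cellWeight ρ β c U ∧ cellWeight ρ β c U ≤ M)
    (hp0 : 0 ≤ M / m - 1) (hp : M / m - 1 ≤ p) : DPRk ρ β S 1 p := by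
  classical
  refine ⟨2 * S + 1, fun _ j => j, isGrid_unit, esAct (N := 2 * S + 1) ρ β m, esZ (N := 2 * S + 1) ρ β m,
    esSub (N := 2 * S + 1) ρ β m, ?_, ?_, ?_, ?_, ?_, ?_, ?_⟩
  · exact lt_of_lt_of_le zero_lt_one
      (one_le_esZ hρ hm (fun c U => (hW c U).1) fun c U => cellFactor_le hm (hW c U).2)
  · intro γ
    obtain ⟨h0, h1⟩ := esAct_bounds hm hW γ
    exact ⟨h0, h1.trans (pow_le_pow_left₀ hp0 hp _)⟩
  · intro Γ hΓ; exact esSub_eq_zero_of_not_compatible hΓ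
  · exact sum_esSub hρ hm hW
  · intro Γ hΓ; exact mass_esSub hρ hm hW hΓ
  · intro Γ hΓ k cA cB A B hAm hBm _ _ hA hB hd hdisj
    exact esSub_indepK hρ hm hW hΓ k cA cB A B hAm hBm hA hB hd hdisj
  · intro k cA A hAm _ hA
    exact esSub_nearFamily hρ hm hW k cA A hAm hA

/-- **The strong-coupling rung of the reshaped es-polymer line** (`EsPolymer.ESRungK`), proved. -/
theorem stub_esRungK : ESRungK := by
  intro G _ _ _ _ _ _ n ρ hρ p hp
  have hcont : Continuous fun g : G => (ρ g).trace.re := Complex.continuous_re.comp hρ.matrix_trace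
  obtain ⟨B, hB⟩ := isCompact_univ.exists_bound_of_continuousOn hcont.continuousOn
  have hB' : ∀ g : G, |(ρ g).trace.re| ≤ B := fun g => by simpa [Real.norm_eq_abs] using hB g (Set.mem_univ g)
  have hB0 : 0 ≤ B := (abs_nonneg _).trans (hB' 1)
  set κ : ℝ := Fintype.card {q : Fin 4 × Fin 4 // q.1 < q.2} * ((n : ℝ) + B) with hκ
  have hκ0 : 0 ≤ κ := by positivity
  have hlog : 0 < Real.log (1 + p) := Real.log_pos (by linarith)
  refine ⟨Real.log (1 + p) / (2 * κ + 1), div_pos hlog (by linarith), fun β hβ S => ?_⟩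
  have h2D : 2 * (|β| * κ) ≤ Real.log (1 + p) := by
    have h1 : |β| * (2 * κ + 1) ≤ Real.log (1 + p) := (le_div_iff₀ (by linarith)).1 hβ
    nlinarith [abs_nonneg β]
  have hMm : Real.exp (|β| * κ) / Real.exp (-(|β| * κ)) = Real.exp (2 * (|β| * κ)) := by
    rw [← Real.exp_sub]; ring_nf
  refine dprk_one_of_bounds S hρ (m := Real.exp (-(|β| * κ))) (M := Real.exp (|β| * κ)) (Real.exp_pos _)
    (fun c U => cellWeight_bounds ρ β hB' c U) ?_ ?_
  · rw [hMm, sub_nonneg]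
    exact Real.one_le_exp (by positivity)
  · rw [hMm, sub_le_iff_le_add]
    calc Real.exp (2 * (|β| * κ)) ≤ Real.exp (Real.log (1 + p)) := Real.exp_le_exp.2 h2D
      _ = p + 1 := by rw [Real.exp_log (by linarith), add_comm]

end Summit.QuantumFields.YangMills.Cruxes.IR.EsPolymer

end
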